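import Summits.QuantumFields.YangMills.Theorems.FluctuationComparisonRegPrIntLS2BetaWhitneyHatLift
import Literature.MathematicalPhysics.QuantumFieldTheory.Balaban1983to89.B15Prop1ChartRecentering
import Summits.QuantumFields.YangMills.Theorems.UnitScaleTiltSU2NearCommuting
import HarnessLib

/-!
# S2β · strata residue (H′) = {(D), (F)} of GAP♯∘ — THE GEODESIC WHITNEY HAT LIFT IS AN EXACT LINEAR `L⁻¹`-CONTRACTION IN LOG-CHART CURRENCY:
# the RELATIVE lift inequality `Σ_b ‖log V b − log Ṽ b‖² ≤ (L⁻¹)²·L^d·Σ_e ‖log X e − log X̃ e‖²` with constant EXACTLY that of (R1), and its chord reading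

Cell `ym3-torus` (rung R3 = continuum `SU(2)` Yang–Mills on the three-torus — NOT d = 4, NOT infinite volume, NOT a mass gap, NOT Clay).
Width seat «width 12» `ym3-torus-px12` (gen 23), FREE px helper on crux `stmt-QuantumFields-20520` (`Theses.UnitScaleTilt.FluctuationComparisonRegPrIntL`),
count-neutral, DEFINITION-FREE (lifts `V`, `Ṽ` and weights `w` pinned by the displayed formulas `hV`, `hṼ`, `hw` of ✓`…S2BetaWhitneyHatLift`).

WHAT IT IS FOR.  After ✓p819037 `hFlat_holds` the registered GAP♯∘ door ✓`…S2BetaGapOrbitOfStrataTwo.uniformFibreGapOrbit_of_strata (hIrr) (hA)` has two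
STRATA letters left; px16 g20's ✓`…S2BetaExcessSplit.excess_floor_of_letters` reduces them to (D) «the RELATIVE telescoped road: distance to the orbit of the
minimiser `U₀` ≤ `C_D`·(relative plaquette action) + small·itself» and (F) (the pairing through criticality).  (D) compares TWO towers (the `U`-tower and the
background tower) level by level, so its lift half needs the RELATIVE form of (R1) — «the lift of `X` and the lift of `X̃` are as close as `X` and `X̃`, with the
factor `√(L^{d−2})`» — and UV3-NODE §71 addendum∕erratum (px12 g23) located the one trap: in GROUP-distance currency the flat-chart lift's relative Lipschitz
constant is `(s∕sin s)·√(L^{d−2})`, not `√(L^{d−2})`.  THIS FILE records the clean fact underneath: in LOG-CHART currency the lift is LINEAR, so the relative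
inequality holds with constant EXACTLY `(L⁻¹)²·L^d` — no curvature loss at all — and the loss appears only when one converts to chords, where the sharp
comparison `‖exp(ιv) − exp(ιw)‖ ≤ ‖v − w‖` (constant 1; the tree had `3‖v − w‖`) keeps the leading constant 1.
* §1 chart facts: `logVec_su2Quat_expPoint` (`log ∘ exp = id` on the OPEN `π`-ball, as vectors), ★`norm_exp_imQuat_sub_exp_imQuat_le_norm_sub`
  (`‖exp(ιv) − exp(ιw)‖ ≤ ‖v − w‖` for ALL `v w` — both sides are affine in `⟪v, w⟫`, endpoints by `1 − x²∕2 ≤ cos x`), `dist1_expPoint_mul_inv_expPoint_le`.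
* §2 the relative lift: `norm_liftExponent_lt_pi`, ★`logVec_lift` (the lift's logarithm IS the hat-weighted mean of the `L⁻¹`-scaled coarse logarithms — exact),
  ★★`sum_sq_logVec_lift_sub_le` (the displayed inequality), `sum_sq_logVec_lift_sub_le_three` (`≤ L·Σ` at `d = 3`), ★★`sum_dist1_sq_lift_mul_inv_le`
  (chord reading, constant still exactly `(L⁻¹)²·L^d`), `norm_logVec_lift_sub_le` (sup companion: `≤ L⁻¹·r` on the column).

HONEST SCOPE.  Finite sums, Jensen, and two facts of the quaternion chart; an OPERATOR statement about arbitrary coarse fields `X X̃` (no datum, no minimiser, no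
measure); nothing of Bałaban's analysis is asserted ([Balaban1985RegularSpaces] (1.29) p.81: geodesic interpolation in local axial gauges); (D), (F), `hIrr`, `hA`,
TUBE-REG∘, GAP♯∘ (`stub_uniformFibreGapOrbit`), S2β, crux 20520 and `YM3TorusSU2` are NOT proved; no registered stub is closed; the Yang–Mills mass gap is NOT proved.
-/

set_option autoImplicit false

noncomputable section

namespace Summit.QuantumFields.YangMills.Theorems.FluctuationComparisonRegPrIntLS2BetaWhitneyHatLiftRelative

open Finset NormedSpace
open scoped Real RealInnerProductSpace BigOperators Quaternion
open Literature.MathematicalPhysics.QuantumLattice (su2Quat norm_su2Quat)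
open Literature.MathematicalPhysics.QuantumFieldTheory.Balaban1983to89
open B10Eq27TorusAxialLog (rel rel_apply)
open T4CubeChartGnomonic (SU2)
open T4HaarSU2ExpChart (imQuat expPoint su2Quat_expPoint exp_imQuat exp_imQuat_re norm_imQuat)
open T4ExpWindowSmallField (logVec norm_logVec imVec norm_imVec_sq)
open B15Prop1ChartRecentering (imVec_exp_imQuat)
open Summit.QuantumFields.YangMills.Theorems.FluctuationComparisonRegPrIntLS2BetaWhitneyHatWeights
  (hatW_nonneg sum_hatW_eq_one sum_hatW_eq_pow)
open Summit.QuantumFields.YangMills.Theorems.FluctuationComparisonRegPrIntLS2BetaGeodesicJensenLift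
  (sq_norm_sum_smul_le norm_sum_smul_le_of_forall_le)

variable {P : Params} {t : ℕ}

/-! ## §1 Two facts of the quaternion chart -/

/-- **`log ∘ exp = id` ON THE OPEN `π`-BALL, AS VECTORS**: `logVec (su2Quat (expPoint v)) = v` for `‖v‖ < π`
(`exp(ιv) = cos‖v‖ + sinc‖v‖·ιv`, `arccos (cos‖v‖) = ‖v‖`, `sinc > 0` on `(0, π)`). [folklore] -/
theorem logVec_su2Quat_expPoint {v : EuclideanSpace ℝ (Fin 3)} (hv : ‖v‖ < π) : logVec (su2Quat (expPoint v)) = v := by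
  rw [su2Quat_expPoint]
  have him : imVec (exp (imQuat v)) = Real.sinc ‖v‖ • v := imVec_exp_imQuat v
  have hre : (exp (imQuat v)).re = Real.cos ‖v‖ := exp_imQuat_re v
  have hac : Real.arccos (Real.cos ‖v‖) = ‖v‖ := Real.arccos_cos (norm_nonneg v) hv.le
  by_cases h0 : v = 0
  · subst h0
    unfold logVec
    rw [him, hre]
    simp
  · have hn : 0 < ‖v‖ := norm_pos_iff.mpr h0
    have hsinc : 0 < Real.sinc ‖v‖ := by
      rw [Real.sinc_of_ne_zero hn.ne']
      exact div_pos (Real.sin_pos_of_pos_of_lt_pi hn hv) hn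
    have hne : imVec (exp (imQuat v)) ≠ 0 := by
      rw [him]
      exact smul_ne_zero hsinc.ne' h0
    unfold logVec
    rw [if_neg hne, him, hre, hac, norm_smul, Real.norm_eq_abs, abs_of_pos hsinc, smul_smul,
      div_mul_eq_mul_div, mul_comm ‖v‖ (Real.sinc ‖v‖), div_self (mul_ne_zero hsinc.ne' hn.ne'), one_smul]

/-- `x · sinc x = sin x`. [folklore] -/
theorem mul_sinc_eq_sin (x : ℝ) : x * Real.sinc x = Real.sin x := by
  by_cases hx : x = 0
  · subst hx; simp
  · rw [Real.sinc_of_ne_zero hx, mul_div_cancel₀ _ hx]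

/-- ★ **THE EXPONENTIAL CHART DOES NOT INCREASE DISTANCES** (leading constant ONE): `‖exp(ιv) − exp(ιw)‖ ≤ ‖v − w‖` for all `v w`.
Both `‖exp(ιv) − exp(ιw)‖² = 2 − 2cos‖v‖cos‖w‖ − 2·sinc‖v‖·sinc‖w‖·⟪v,w⟫` and `‖v − w‖²` are affine in `⟪v, w⟫ ≤ ‖v‖‖w‖` with `sinc·sinc ≤ 1`, and at
`⟪v,w⟫ = ‖v‖‖w‖` the claim is `2 − 2cos(‖v‖ − ‖w‖) ≤ (‖v‖ − ‖w‖)²`. (The tree's ✓`norm_exp_imQuat_sub_exp_imQuat_le` has constant 3.) [folklore] -/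
theorem norm_exp_imQuat_sub_exp_imQuat_le_norm_sub (v w : EuclideanSpace ℝ (Fin 3)) :
    ‖exp (imQuat v) - exp (imQuat w)‖ ≤ ‖v - w‖ := by
  -- the two quaternion bookkeeping facts (`‖q‖² = re² + ‖im q‖²`, `im` is additive) are ✓`…UniformGauge.norm_sq_eq_re_sq_add_norm_imVec_sq`
  -- ∕ `norm_imVec_sub_le`'s inline step; restated here as local `have`s to keep this file's imports inside the S2β lineage.
  have norm_sq_eq_re_sq_add : ∀ q : ℍ, ‖q‖ ^ 2 = q.re ^ 2 + ‖imVec q‖ ^ 2 := fun q => by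
    rw [norm_imVec_sq, sq, ← Quaternion.normSq_eq_norm_mul_self, Quaternion.normSq_def']
    ring
  have imVec_sub : ∀ p q : ℍ, imVec (p - q) = imVec p - imVec q := fun p q => by
    ext i; fin_cases i <;> simp [imVec]
  have hsq : ‖exp (imQuat v) - exp (imQuat w)‖ ^ 2 =
      2 - 2 * (Real.cos ‖v‖ * Real.cos ‖w‖) - 2 * (Real.sinc ‖v‖ * Real.sinc ‖w‖) * inner ℝ v w := by
    rw [norm_sq_eq_re_sq_add, imVec_sub, imVec_exp_imQuat, imVec_exp_imQuat, Quaternion.re_sub, exp_imQuat_re, exp_imQuat_re,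
      norm_sub_sq_real, norm_smul, norm_smul, real_inner_smul_left, real_inner_smul_right, Real.norm_eq_abs, Real.norm_eq_abs,
      mul_pow, mul_pow, sq_abs, sq_abs]
    have h1 : Real.sinc ‖v‖ ^ 2 * ‖v‖ ^ 2 = Real.sin ‖v‖ ^ 2 := by rw [← mul_pow, mul_comm, mul_sinc_eq_sin]
    have h2 : Real.sinc ‖w‖ ^ 2 * ‖w‖ ^ 2 = Real.sin ‖w‖ ^ 2 := by rw [← mul_pow, mul_comm, mul_sinc_eq_sin]
    rw [h1, h2]
    nlinarith [Real.sin_sq_add_cos_sq ‖v‖, Real.sin_sq_add_cos_sq ‖w‖]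
  have hvw : ‖v - w‖ ^ 2 = ‖v‖ ^ 2 - 2 * inner ℝ v w + ‖w‖ ^ 2 := norm_sub_sq_real v w
  have hS : Real.sinc ‖v‖ * Real.sinc ‖w‖ ≤ 1 := by
    have := abs_mul (Real.sinc ‖v‖) (Real.sinc ‖w‖) ▸ mul_le_one₀ (Real.abs_sinc_le_one ‖v‖) (abs_nonneg _) (Real.abs_sinc_le_one ‖w‖)
    exact (le_abs_self _).trans this
  have ht : inner ℝ v w ≤ ‖v‖ * ‖w‖ := real_inner_le_norm v w
  have hcos : 1 - (‖v‖ - ‖w‖) ^ 2 / 2 ≤ Real.cos (‖v‖ - ‖w‖) := Real.one_sub_sq_div_two_le_cos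
  have hend : 2 - 2 * Real.cos (‖v‖ - ‖w‖) ≤ (‖v‖ - ‖w‖) ^ 2 := by linarith
  rw [Real.cos_sub] at hend
  have hss : Real.sin ‖v‖ * Real.sin ‖w‖ = Real.sinc ‖v‖ * Real.sinc ‖w‖ * (‖v‖ * ‖w‖) := by
    rw [← mul_sinc_eq_sin, ← mul_sinc_eq_sin]; ring
  have key : ‖exp (imQuat v) - exp (imQuat w)‖ ^ 2 ≤ ‖v - w‖ ^ 2 := by
    rw [hsq, hvw]
    nlinarith [mul_le_mul_of_nonneg_left ht (sub_nonneg.mpr hS)]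
  exact (pow_le_pow_iff_left₀ (norm_nonneg _) (norm_nonneg _) two_ne_zero).mp key

/-- The same in `dist1` currency on `SU(2)`: `dist1 (expPoint v · (expPoint w)⁻¹) ≤ ‖v − w‖`. [folklore] -/
theorem dist1_expPoint_mul_inv_expPoint_le (v w : EuclideanSpace ℝ (Fin 3)) :
    dist1 (expPoint v * (expPoint w)⁻¹) ≤ ‖v - w‖ := by
  rw [SU2NearCommuting.dist1_mul_inv_eq_norm_sub, su2Quat_expPoint, su2Quat_expPoint]
  exact norm_exp_imQuat_sub_exp_imQuat_le_norm_sub v w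


/-! ## §2 The relative lift inequality — the lift is linear in log-chart currency -/

/-- The lift exponent of a fine bond is a convex combination of vectors of norm `≤ L⁻¹·π`, hence has norm `≤ L⁻¹·π`. [folklore] -/
theorem norm_liftExponent_le (ht : t + 1 ≤ P.m + P.K) (w : PBond P t → PBond P (t + 1) → ℝ)
    (hw : ∀ b e, w b e = if e.dir = b.dir ∧ (b.src b.dir - emb e.src b.dir).val < P.L then
      ∏ ν ∈ Finset.univ.erase b.dir, max 0 (1 - ((rel (emb e.src) b.src ν).natAbs : ℝ) / P.L) else 0)
    (X : GaugeField P (t + 1) SU2) (b : PBond P t) :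
    ‖∑ e, w b e • ((P.L : ℝ)⁻¹ • logVec (su2Quat (X e)))‖ ≤ (P.L : ℝ)⁻¹ * π := by
  refine norm_sum_smul_le_of_forall_le Finset.univ (fun e _ => hatW_nonneg w hw b e) (sum_hatW_eq_one ht w hw b) fun e _ => ?_
  rw [norm_smul, Real.norm_eq_abs, abs_of_nonneg (inv_nonneg.mpr (Nat.cast_nonneg _))]
  exact mul_le_mul_of_nonneg_left (T4ExpWindowSmallField.norm_logVec_le_pi _) (inv_nonneg.mpr (Nat.cast_nonneg _))

/-- … and since `L ≥ 2` that is `< π`: the lift exponent lies in the OPEN `π`-ball (where `log ∘ exp = id`). [folklore] -/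
theorem norm_liftExponent_lt_pi (ht : t + 1 ≤ P.m + P.K) (w : PBond P t → PBond P (t + 1) → ℝ)
    (hw : ∀ b e, w b e = if e.dir = b.dir ∧ (b.src b.dir - emb e.src b.dir).val < P.L then
      ∏ ν ∈ Finset.univ.erase b.dir, max 0 (1 - ((rel (emb e.src) b.src ν).natAbs : ℝ) / P.L) else 0)
    (X : GaugeField P (t + 1) SU2) (b : PBond P t) :
    ‖∑ e, w b e • ((P.L : ℝ)⁻¹ • logVec (su2Quat (X e)))‖ < π := by
  refine (norm_liftExponent_le ht w hw X b).trans_lt ?_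
  have hL : (2 : ℝ) ≤ P.L := by exact_mod_cast P.hL.2
  have hLinv : (P.L : ℝ)⁻¹ ≤ 1 / 2 := by
    rw [inv_eq_one_div]
    exact one_div_le_one_div_of_le two_pos hL
  nlinarith [Real.pi_pos]

/-- ★ **THE LIFT'S LOGARITHM IS THE HAT-WEIGHTED MEAN OF THE `L⁻¹`-SCALED COARSE LOGARITHMS — EXACTLY**:
`logVec (su2Quat (V b)) = Σ_e w b e • L⁻¹ • logVec (su2Quat (X e))` (in log-chart coordinates the lift is a LINEAR map). [cite: Balaban1985RegularSpaces, (1.29) p.81] -/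
theorem logVec_lift (ht : t + 1 ≤ P.m + P.K) (w : PBond P t → PBond P (t + 1) → ℝ)
    (hw : ∀ b e, w b e = if e.dir = b.dir ∧ (b.src b.dir - emb e.src b.dir).val < P.L then
      ∏ ν ∈ Finset.univ.erase b.dir, max 0 (1 - ((rel (emb e.src) b.src ν).natAbs : ℝ) / P.L) else 0)
    (X : GaugeField P (t + 1) SU2) (V : GaugeField P t SU2)
    (hV : ∀ b, V b = expPoint (∑ e, w b e • ((P.L : ℝ)⁻¹ • logVec (su2Quat (X e))))) (b : PBond P t) :
    logVec (su2Quat (V b)) = ∑ e, w b e • ((P.L : ℝ)⁻¹ • logVec (su2Quat (X e))) := by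
  rw [hV, logVec_su2Quat_expPoint (norm_liftExponent_lt_pi ht w hw X b)]

/-- The difference of two lift exponents is the lift exponent of the difference of logarithms (linearity). [folklore] -/
theorem liftExponent_sub (w : PBond P t → PBond P (t + 1) → ℝ) (X X' : GaugeField P (t + 1) SU2) (b : PBond P t) :
    ∑ e, w b e • ((P.L : ℝ)⁻¹ • logVec (su2Quat (X e))) - ∑ e, w b e • ((P.L : ℝ)⁻¹ • logVec (su2Quat (X' e)))
      = ∑ e, w b e • ((P.L : ℝ)⁻¹ • (logVec (su2Quat (X e)) - logVec (su2Quat (X' e)))) := by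
  rw [← Finset.sum_sub_distrib]
  refine Finset.sum_congr rfl fun e _ => ?_
  rw [smul_sub, smul_sub]

/-- **JENSEN FOR THE EXPONENT DIFFERENCE** (one fine bond): `‖v b − v′ b‖² ≤ (L⁻¹)²·Σ_e w b e·‖log X e − log X′ e‖²`. [folklore] -/
theorem sq_norm_liftExponent_sub_le (ht : t + 1 ≤ P.m + P.K) (w : PBond P t → PBond P (t + 1) → ℝ)
    (hw : ∀ b e, w b e = if e.dir = b.dir ∧ (b.src b.dir - emb e.src b.dir).val < P.L then
      ∏ ν ∈ Finset.univ.erase b.dir, max 0 (1 - ((rel (emb e.src) b.src ν).natAbs : ℝ) / P.L) else 0)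
    (X X' : GaugeField P (t + 1) SU2) (b : PBond P t) :
    ‖∑ e, w b e • ((P.L : ℝ)⁻¹ • logVec (su2Quat (X e))) - ∑ e, w b e • ((P.L : ℝ)⁻¹ • logVec (su2Quat (X' e)))‖ ^ 2
      ≤ ((P.L : ℝ)⁻¹) ^ 2 * ∑ e, w b e * ‖logVec (su2Quat (X e)) - logVec (su2Quat (X' e))‖ ^ 2 := by
  rw [liftExponent_sub, Finset.mul_sum]
  refine (sq_norm_sum_smul_le Finset.univ (fun e _ => hatW_nonneg w hw b e) (sum_hatW_eq_one ht w hw b) _).trans (le_of_eq ?_)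
  refine Finset.sum_congr rfl fun e _ => ?_
  rw [norm_smul, Real.norm_eq_abs, abs_of_nonneg (inv_nonneg.mpr (Nat.cast_nonneg _)), mul_pow]
  ring

/-- One fine bond, log-chart currency: `‖log V b − log Ṽ b‖² ≤ (L⁻¹)²·Σ_e w b e·‖log X e − log X̃ e‖²`. [folklore] -/
theorem sq_norm_logVec_lift_sub_le (ht : t + 1 ≤ P.m + P.K) (w : PBond P t → PBond P (t + 1) → ℝ)
    (hw : ∀ b e, w b e = if e.dir = b.dir ∧ (b.src b.dir - emb e.src b.dir).val < P.L then
      ∏ ν ∈ Finset.univ.erase b.dir, max 0 (1 - ((rel (emb e.src) b.src ν).natAbs : ℝ) / P.L) else 0)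
    (X X' : GaugeField P (t + 1) SU2) (V V' : GaugeField P t SU2)
    (hV : ∀ b, V b = expPoint (∑ e, w b e • ((P.L : ℝ)⁻¹ • logVec (su2Quat (X e)))))
    (hV' : ∀ b, V' b = expPoint (∑ e, w b e • ((P.L : ℝ)⁻¹ • logVec (su2Quat (X' e))))) (b : PBond P t) :
    ‖logVec (su2Quat (V b)) - logVec (su2Quat (V' b))‖ ^ 2
      ≤ ((P.L : ℝ)⁻¹) ^ 2 * ∑ e, w b e * ‖logVec (su2Quat (X e)) - logVec (su2Quat (X' e))‖ ^ 2 := by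
  rw [logVec_lift ht w hw X V hV b, logVec_lift ht w hw X' V' hV' b]
  exact sq_norm_liftExponent_sub_le ht w hw X X' b

/-- ★★ **THE RELATIVE LIFT INEQUALITY, LOG-CHART CURRENCY, CONSTANT EXACTLY `(L⁻¹)²·L^d`** (= that of the radial (R1) ✓`sum_sq_arc_lift_le`):
`Σ_b ‖log V b − log Ṽ b‖² ≤ (L⁻¹)²·L^d·Σ_e ‖log X e − log X̃ e‖²` for ANY two coarse fields `X X̃` — the lift is a linear `√(L^{d−2})`-bounded map of log coordinates;
no smallness, no curvature defect. [cite: Balaban1985RegularSpaces, (1.29) p.81] -/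
theorem sum_sq_logVec_lift_sub_le (ht : t + 1 ≤ P.m + P.K) (w : PBond P t → PBond P (t + 1) → ℝ)
    (hw : ∀ b e, w b e = if e.dir = b.dir ∧ (b.src b.dir - emb e.src b.dir).val < P.L then
      ∏ ν ∈ Finset.univ.erase b.dir, max 0 (1 - ((rel (emb e.src) b.src ν).natAbs : ℝ) / P.L) else 0)
    (X X' : GaugeField P (t + 1) SU2) (V V' : GaugeField P t SU2)
    (hV : ∀ b, V b = expPoint (∑ e, w b e • ((P.L : ℝ)⁻¹ • logVec (su2Quat (X e)))))
    (hV' : ∀ b, V' b = expPoint (∑ e, w b e • ((P.L : ℝ)⁻¹ • logVec (su2Quat (X' e))))) :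
    ∑ b, ‖logVec (su2Quat (V b)) - logVec (su2Quat (V' b))‖ ^ 2
      ≤ ((P.L : ℝ)⁻¹) ^ 2 * (P.L : ℝ) ^ P.d * ∑ e, ‖logVec (su2Quat (X e)) - logVec (su2Quat (X' e))‖ ^ 2 := by
  calc ∑ b, ‖logVec (su2Quat (V b)) - logVec (su2Quat (V' b))‖ ^ 2
      ≤ ∑ b, ((P.L : ℝ)⁻¹) ^ 2 * ∑ e, w b e * ‖logVec (su2Quat (X e)) - logVec (su2Quat (X' e))‖ ^ 2 :=
        Finset.sum_le_sum fun b _ => sq_norm_logVec_lift_sub_le ht w hw X X' V V' hV hV' b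
    _ = ((P.L : ℝ)⁻¹) ^ 2 * (P.L : ℝ) ^ P.d * ∑ e, ‖logVec (su2Quat (X e)) - logVec (su2Quat (X' e))‖ ^ 2 := by
        -- `Σ_b Σ_e w b e·G e = L^d·Σ_e G e` (✓`…WhitneyHatLiftCurvatureSq.sum_sum_hatW_mul_eq`, two lines, restated inline to keep imports light)
        have hmass : ∀ G : PBond P (t + 1) → ℝ, ∑ b : PBond P t, ∑ e, w b e * G e = (P.L : ℝ) ^ P.d * ∑ e, G e := fun G => by
          rw [Finset.sum_comm, Finset.mul_sum]
          exact Finset.sum_congr rfl fun e _ => by rw [← Finset.sum_mul, sum_hatW_eq_pow ht w hw e]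
        rw [← Finset.mul_sum, hmass, mul_assoc]

/-- The `d = 3` reading: `Σ_b ‖log V b − log Ṽ b‖² ≤ L·Σ_e ‖log X e − log X̃ e‖²` — per-level factor EXACTLY `√L` for the two-tower recursion of (D). [folklore] -/
theorem sum_sq_logVec_lift_sub_le_three (hd : P.d = 3) (ht : t + 1 ≤ P.m + P.K) (w : PBond P t → PBond P (t + 1) → ℝ)
    (hw : ∀ b e, w b e = if e.dir = b.dir ∧ (b.src b.dir - emb e.src b.dir).val < P.L then
      ∏ ν ∈ Finset.univ.erase b.dir, max 0 (1 - ((rel (emb e.src) b.src ν).natAbs : ℝ) / P.L) else 0)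
    (X X' : GaugeField P (t + 1) SU2) (V V' : GaugeField P t SU2)
    (hV : ∀ b, V b = expPoint (∑ e, w b e • ((P.L : ℝ)⁻¹ • logVec (su2Quat (X e)))))
    (hV' : ∀ b, V' b = expPoint (∑ e, w b e • ((P.L : ℝ)⁻¹ • logVec (su2Quat (X' e))))) :
    ∑ b, ‖logVec (su2Quat (V b)) - logVec (su2Quat (V' b))‖ ^ 2 ≤ (P.L : ℝ) * ∑ e, ‖logVec (su2Quat (X e)) - logVec (su2Quat (X' e))‖ ^ 2 := by
  have h := sum_sq_logVec_lift_sub_le ht w hw X X' V V' hV hV'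
  have hL : (P.L : ℝ) ≠ 0 := (Nat.cast_pos.mpr P.L_pos).ne'
  rwa [hd, show ((P.L : ℝ)⁻¹) ^ 2 * (P.L : ℝ) ^ 3 = P.L by field_simp] at h

/-- ★★ **CHORD READING, CONSTANT STILL EXACTLY `(L⁻¹)²·L^d`**: `Σ_b dist1 (V b · (Ṽ b)⁻¹)² ≤ (L⁻¹)²·L^d·Σ_e ‖log X e − log X̃ e‖²` (§1's sharp
`‖exp(ιv) − exp(ιw)‖ ≤ ‖v − w‖`, then Jensen and the hat mass). [folklore] -/
theorem sum_dist1_sq_lift_mul_inv_le (ht : t + 1 ≤ P.m + P.K) (w : PBond P t → PBond P (t + 1) → ℝ)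
    (hw : ∀ b e, w b e = if e.dir = b.dir ∧ (b.src b.dir - emb e.src b.dir).val < P.L then
      ∏ ν ∈ Finset.univ.erase b.dir, max 0 (1 - ((rel (emb e.src) b.src ν).natAbs : ℝ) / P.L) else 0)
    (X X' : GaugeField P (t + 1) SU2) (V V' : GaugeField P t SU2)
    (hV : ∀ b, V b = expPoint (∑ e, w b e • ((P.L : ℝ)⁻¹ • logVec (su2Quat (X e)))))
    (hV' : ∀ b, V' b = expPoint (∑ e, w b e • ((P.L : ℝ)⁻¹ • logVec (su2Quat (X' e))))) :
    ∑ b, dist1 (V b * (V' b)⁻¹) ^ 2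
      ≤ ((P.L : ℝ)⁻¹) ^ 2 * (P.L : ℝ) ^ P.d * ∑ e, ‖logVec (su2Quat (X e)) - logVec (su2Quat (X' e))‖ ^ 2 := by
  calc ∑ b, dist1 (V b * (V' b)⁻¹) ^ 2
      ≤ ∑ b, ((P.L : ℝ)⁻¹) ^ 2 * ∑ e, w b e * ‖logVec (su2Quat (X e)) - logVec (su2Quat (X' e))‖ ^ 2 := by
        refine Finset.sum_le_sum fun b _ => ?_
        have h1 : dist1 (V b * (V' b)⁻¹) ≤
            ‖∑ e, w b e • ((P.L : ℝ)⁻¹ • logVec (su2Quat (X e))) - ∑ e, w b e • ((P.L : ℝ)⁻¹ • logVec (su2Quat (X' e)))‖ := by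
          rw [hV b, hV' b]
          exact dist1_expPoint_mul_inv_expPoint_le _ _
        exact (pow_le_pow_left₀ (GaugeGroup.dist1_nonneg _) h1 2).trans (sq_norm_liftExponent_sub_le ht w hw X X' b)
    _ = ((P.L : ℝ)⁻¹) ^ 2 * (P.L : ℝ) ^ P.d * ∑ e, ‖logVec (su2Quat (X e)) - logVec (su2Quat (X' e))‖ ^ 2 := by
        -- `Σ_b Σ_e w b e·G e = L^d·Σ_e G e` (✓`…WhitneyHatLiftCurvatureSq.sum_sum_hatW_mul_eq`, two lines, restated inline to keep imports light)
        have hmass : ∀ G : PBond P (t + 1) → ℝ, ∑ b : PBond P t, ∑ e, w b e * G e = (P.L : ℝ) ^ P.d * ∑ e, G e := fun G => by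
          rw [Finset.sum_comm, Finset.mul_sum]
          exact Finset.sum_congr rfl fun e _ => by rw [← Finset.sum_mul, sum_hatW_eq_pow ht w hw e]
        rw [← Finset.mul_sum, hmass, mul_assoc]

/-- **SUP COMPANION** (one fine bond): if every coarse bond feeding `b` (`w b e ≠ 0`) has `‖log X e − log X̃ e‖ ≤ r`, then `‖log V b − log Ṽ b‖ ≤ L⁻¹·r`
(a convex combination of vectors of norm `≤ L⁻¹ r`). [folklore] -/
theorem norm_logVec_lift_sub_le (ht : t + 1 ≤ P.m + P.K) (w : PBond P t → PBond P (t + 1) → ℝ)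
    (hw : ∀ b e, w b e = if e.dir = b.dir ∧ (b.src b.dir - emb e.src b.dir).val < P.L then
      ∏ ν ∈ Finset.univ.erase b.dir, max 0 (1 - ((rel (emb e.src) b.src ν).natAbs : ℝ) / P.L) else 0)
    (X X' : GaugeField P (t + 1) SU2) (V V' : GaugeField P t SU2)
    (hV : ∀ b, V b = expPoint (∑ e, w b e • ((P.L : ℝ)⁻¹ • logVec (su2Quat (X e)))))
    (hV' : ∀ b, V' b = expPoint (∑ e, w b e • ((P.L : ℝ)⁻¹ • logVec (su2Quat (X' e)))))
    (b : PBond P t) {r : ℝ} (hr : ∀ e, w b e ≠ 0 → ‖logVec (su2Quat (X e)) - logVec (su2Quat (X' e))‖ ≤ r) :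
    ‖logVec (su2Quat (V b)) - logVec (su2Quat (V' b))‖ ≤ (P.L : ℝ)⁻¹ * r := by
  classical
  rw [logVec_lift ht w hw X V hV b, logVec_lift ht w hw X' V' hV' b, liftExponent_sub]
  set S : Finset (PBond P (t + 1)) := Finset.univ.filter fun e => w b e ≠ 0 with hS
  have hsub : ∑ e ∈ S, w b e • ((P.L : ℝ)⁻¹ • (logVec (su2Quat (X e)) - logVec (su2Quat (X' e))))
      = ∑ e, w b e • ((P.L : ℝ)⁻¹ • (logVec (su2Quat (X e)) - logVec (su2Quat (X' e)))) := by
    refine Finset.sum_subset (Finset.subset_univ S) fun e _ he => ?_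
    have : w b e = 0 := by simpa [hS] using he
    rw [this, zero_smul]
  have hone : ∑ e ∈ S, w b e = 1 := by
    rw [← sum_hatW_eq_one ht w hw b]
    refine Finset.sum_subset (Finset.subset_univ S) fun e _ he => ?_
    simpa [hS] using he
  rw [← hsub]
  refine norm_sum_smul_le_of_forall_le S (fun e _ => hatW_nonneg w hw b e) hone fun e he => ?_
  have hne : w b e ≠ 0 := by simpa [hS] using he
  rw [norm_smul, Real.norm_eq_abs, abs_of_nonneg (inv_nonneg.mpr (Nat.cast_nonneg _))]
  exact mul_le_mul_of_nonneg_left (hr e hne) (inv_nonneg.mpr (Nat.cast_nonneg _))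

end Summit.QuantumFields.YangMills.Theorems.FluctuationComparisonRegPrIntLS2BetaWhitneyHatLiftRelative

end
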